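import Summits.QuantumFields.YangMills.Theorems.BalabanUVNodesN21HazardFromLogLipschitz

/-!
# N21 (NE7c) · the log-Lipschitz hazard device on a BOUNDED fibre, and the Gaussian cross-check (Mills-free)

R134 seat pub-ymgap-dag-n21-d (g8), node N21 = NE7c (single-run shell-weight bound, NOT PRINTED in [Bałaban 1983–89],
NOT proved), lane K3⁷ `SpineGivenEndpointR13SepCoPH` (stmt-QuantumFields-20544, `--kind proof --supports … --as helper`).
Part 13 of the comparison series; consumes part 8 (`…N21HazardFromLogLipschitz`) only (independent of parts 9–12).

WHAT THIS FILE IS.  Two riders on part 8's one-dimensional device.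
* §1 BOUNDED FIBRES.  Bałaban's fluctuation variables range over a compact group ∕ a small-field BALL, not over `ℝ`:
  the fibre density is `e^{−W}·1_I` for an interval `I`.  Part 8 §1–§2 (general non-collapse) already covers this:
  the indicator is constant `1` on the right `δ`-neighbourhoods of the shell as soon as `[a, b + δ] ⊆ I` («room to
  the right of the threshold inside the fibre»), so `μ[a, b) ≤ e·Λ·(b − a) · μ[a, b + Λ⁻¹]` for the truncated density
  (`withDensity_indicator_exp_neg_Ico_le_of_logLipschitz`); the only new side condition is `b + Λ⁻¹ ≤ sup I`.
* §2 THE GAUSSIAN CROSS-CHECK.  For `W(y) = y²∕(2v)` (the `N(0, v)` fibre of parts 2–3, up to normalisation) and a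
  shell `[a, b)` with `0 ≤ a ≤ b`, the one-sided slope on `[a, b + Λ⁻¹]` is `≤ Λ := b∕v + 1∕√v`
  (`quadratic_logLipschitz`), so part 8 gives the windowed hazard bound with constant `e·(b∕v + 1∕√v)·(b − a)`
  (`withDensity_gaussianWeight_Ico_le`) — the same shape as part 7 §4–§5's Mills-ratio constant
  `(b⁺∕√v + 4)·(b − a)∕√v = (b∕v + 4∕√v)(b − a)`, obtained WITHOUT Mills' ratio, Gordon's inequality or `Φ′ = φ`:
  the slope of the action across one shell width is all that enters (lens Card 51's `x² = (θ∕σ)²` profile is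
  `Λ·θ` here).

WHICH LAW (lens v22.0 ROW L ∕ Card 65).  The rightward device of parts 8–10, 12 and of this file is stated for the
fibre law WITHOUT the slot's own cut `𝟙_{u<θ}` (`T4ShellMeasure` :598's reading «with the slot's own indicator factor
removed»; all other cuts ride along); on a law carrying `𝟙_{u<θ}` itself the rightward hypothesis is VOID (lens
Sketch-g22 §L `nonCollapse_right_forces_zero`, landed in part 14 `…N21LeftNonCollapseHazard`), the transfer to the cut
law being part 11 (`…N21ShellFractionLargeFieldOdds`: hazard constant × large-field odds) or part 14's LEFT device.
§1's «room to the right inside the fibre» is about the fibre's RANGE cut (small-field ball of the integration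
variable), not about the tested variable's own threshold.

HONEST FRAMING.  [textbook] real analysis; 0 def, 0 sorry; nothing of Bałaban's asserted; NE7c NOT PRINTED ∕ NOT
proved; N21 NOT discharged; counts unmoved (typed 28∕28 · discharged 5∕27); count-neutral; one finite 𝕋⁴ at fixed ε —
nothing about ℝ⁴ ∕ OS ∕ mass gap ∕ Clay.
-/

open MeasureTheory Set
open scoped ENNReal NNReal

namespace Summit.QuantumFields.YangMills.Theorems.N21HazardBoundedFibre

open Summit.QuantumFields.YangMills.Theorems.N21HazardFromLogLipschitz
  (withDensity_Ico_le_Icc_of_nonCollapse nonCollapse_of_logLipschitz withDensity_exp_neg_Ico_le_of_logLipschitz)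

/-! ## §1 Bounded fibres: the density `e^{−W}·1_I` -/

/-- non-collapse survives truncation to an interval containing the right `δ`-neighbourhoods of the window:
if `[a, b + δ] ⊆ I` then `(e^{−W}·1_I)(x) ≤ M·(e^{−W}·1_I)(y)` for `x ∈ [a, b)`, `y ∈ [x, x + δ]` whenever
`e^{−W}(x) ≤ M·e^{−W}(y)` there. [textbook] -/
theorem nonCollapse_indicator_of_subset {f : ℝ → ℝ≥0∞} {I : Set ℝ} {a b δ : ℝ} (hI : Icc a (b + δ) ⊆ I)
    (M : ℝ≥0∞) (h : ∀ x ∈ Ico a b, ∀ y ∈ Icc x (x + δ), f x ≤ M * f y) :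
    ∀ x ∈ Ico a b, ∀ y ∈ Icc x (x + δ), I.indicator f x ≤ M * I.indicator f y := by
  intro x hx y hy
  have hyI : y ∈ I := hI ⟨hx.1.trans hy.1, by linarith [hy.2, hx.2]⟩
  rw [indicator_of_mem hyI]
  exact (indicator_le_self _ _ x).trans (h x hx y hy)

/-- **LOG-LIPSCHITZ HAZARD ON A BOUNDED FIBRE.**  Density `e^{−W}·1_I` (`W` measurable, one-sided slope `≤ Λ`, `Λ > 0`,
on the right `Λ⁻¹`-neighbourhoods of the window; `I` a measurable set containing `[a, b + Λ⁻¹]` — room to the right of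
the threshold inside the fibre): `μ[a, b) ≤ e·Λ·(b − a) · μ[a, b + Λ⁻¹]`. [textbook] -/
theorem withDensity_indicator_exp_neg_Ico_le_of_logLipschitz {W : ℝ → ℝ} (hWm : Measurable W) {I : Set ℝ}
    (hIm : MeasurableSet I) {a b Λ : ℝ} (hΛ : 0 < Λ) (hI : Icc a (b + Λ⁻¹) ⊆ I)
    (hW : ∀ x ∈ Ico a b, ∀ y ∈ Icc x (x + Λ⁻¹), W y - W x ≤ Λ * (y - x)) :
    volume.withDensity (I.indicator fun x => ENNReal.ofReal (Real.exp (-W x))) (Ico a b)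
      ≤ ENNReal.ofReal (Real.exp 1 * Λ * (b - a))
        * volume.withDensity (I.indicator fun x => ENNReal.ofReal (Real.exp (-W x))) (Icc a (b + Λ⁻¹)) := by
  have hf : Measurable (I.indicator fun x => ENNReal.ofReal (Real.exp (-W x))) :=
    (ENNReal.measurable_ofReal.comp (Real.measurable_exp.comp hWm.neg)).indicator hIm
  have hnc := nonCollapse_indicator_of_subset hI (ENNReal.ofReal (Real.exp (Λ * Λ⁻¹)))
    (nonCollapse_of_logLipschitz hΛ.le hW)
  have h := withDensity_Ico_le_Icc_of_nonCollapse hf (inv_pos.2 hΛ) _ hnc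
  rw [mul_inv_cancel₀ hΛ.ne'] at h
  refine h.trans (le_of_eq ?_)
  rw [← ENNReal.ofReal_mul (Real.exp_pos 1).le]
  congr 2
  rw [div_eq_mul_inv, inv_inv]
  ring

/-- … relative to the whole exceedance set inside the fibre: `μ[a, b) ≤ e·Λ·(b − a) · μ[a, ∞)` (the hypothesis
shape of part 7 §3 for a bounded-fibre coordinate law). [textbook] -/
theorem withDensity_indicator_exp_neg_Ico_le_Ici_of_logLipschitz {W : ℝ → ℝ} (hWm : Measurable W) {I : Set ℝ}
    (hIm : MeasurableSet I) {a b Λ : ℝ} (hΛ : 0 < Λ) (hI : Icc a (b + Λ⁻¹) ⊆ I)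
    (hW : ∀ x ∈ Ico a b, ∀ y ∈ Icc x (x + Λ⁻¹), W y - W x ≤ Λ * (y - x)) :
    volume.withDensity (I.indicator fun x => ENNReal.ofReal (Real.exp (-W x))) (Ico a b)
      ≤ ENNReal.ofReal (Real.exp 1 * Λ * (b - a))
        * volume.withDensity (I.indicator fun x => ENNReal.ofReal (Real.exp (-W x))) (Ici a) :=
  (withDensity_indicator_exp_neg_Ico_le_of_logLipschitz hWm hIm hΛ hI hW).trans
    (mul_le_mul_right (measure_mono fun _ hy => hy.1) _)

/-! ## §2 The Gaussian cross-check: `W(y) = y²∕(2v)` has slope `≤ b∕v + 1∕√v` on `[a, b + Λ⁻¹]`, `0 ≤ a ≤ b` -/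

/-- the quadratic action's one-sided slope below `b ≥ 0`: for `x ≤ b`, `x ≤ y ≤ x + Λ⁻¹` with
`Λ = b∕v + 1∕√v` (`v > 0`): `y²∕(2v) − x²∕(2v) ≤ Λ·(y − x)`. [textbook] -/
theorem quadratic_logLipschitz {v b : ℝ} (hv : 0 < v) (hb : 0 ≤ b) {x y : ℝ} (hxb : x ≤ b)
    (hxy : x ≤ y) (hy : y ≤ x + (b / v + 1 / Real.sqrt v)⁻¹) :
    y ^ 2 / (2 * v) - x ^ 2 / (2 * v) ≤ (b / v + 1 / Real.sqrt v) * (y - x) := by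
  have hsv : 0 < Real.sqrt v := Real.sqrt_pos.2 hv
  have hsq : Real.sqrt v * Real.sqrt v = v := Real.mul_self_sqrt hv.le
  set Λ := b / v + 1 / Real.sqrt v with hΛ
  have hΛpos : 0 < Λ := by positivity
  -- `y + x ≤ 2b + Λ⁻¹` and `(2b + Λ⁻¹)/(2v) ≤ Λ`
  have hsum : y + x ≤ 2 * b + Λ⁻¹ := by linarith
  have hkey : (2 * b + Λ⁻¹) / (2 * v) ≤ Λ := by
    rw [div_le_iff₀ (by positivity)]
    -- `2b + Λ⁻¹ ≤ 2vΛ = 2b + 2√v`: i.e. `Λ⁻¹ ≤ 2√v`, true since `Λ ≥ 1/√v`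
    have hΛge : 1 / Real.sqrt v ≤ Λ := by
      have : 0 ≤ b / v := div_nonneg hb hv.le
      linarith
    have hinv : Λ⁻¹ ≤ Real.sqrt v := by
      rw [inv_le_comm₀ hΛpos hsv]
      simpa [one_div] using hΛge
    have h2 : Λ * (2 * v) = 2 * b + 2 * Real.sqrt v := by
      rw [hΛ]
      field_simp
      nlinarith [hsq]
    nlinarith
  have hfac : y ^ 2 / (2 * v) - x ^ 2 / (2 * v) = (y + x) / (2 * v) * (y - x) := by
    field_simp
    ring
  rw [hfac]
  refine mul_le_mul_of_nonneg_right ?_ (by linarith)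
  exact (div_le_div_of_nonneg_right hsum (by positivity)).trans hkey

/-- **THE GAUSSIAN WINDOWED HAZARD BOUND, MILLS-FREE.**  For the (unnormalised) `N(0, v)` weight `e^{−y²∕(2v)}` and a
shell `0 ≤ a ≤ b`: `μ[a, b) ≤ e·(b∕v + 1∕√v)·(b − a) · μ[a, ∞)` — part 8 §3 at `Λ = b∕v + 1∕√v`; compare part 7's
Mills-ratio constant `(b∕v + 4∕√v)(b − a)` (`gaussianReal_var_Ico_le_hazard_mul_Ici`). [textbook] -/
theorem withDensity_gaussianWeight_Ico_le {v a b : ℝ} (hv : 0 < v) (ha : 0 ≤ a) (hab : a ≤ b) :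
    volume.withDensity (fun y => ENNReal.ofReal (Real.exp (-(y ^ 2 / (2 * v))))) (Ico a b)
      ≤ ENNReal.ofReal (Real.exp 1 * (b / v + 1 / Real.sqrt v) * (b - a))
        * volume.withDensity (fun y => ENNReal.ofReal (Real.exp (-(y ^ 2 / (2 * v))))) (Ici a) := by
  have hΛ : 0 < b / v + 1 / Real.sqrt v := by
    have : 0 < Real.sqrt v := Real.sqrt_pos.2 hv
    have : 0 ≤ b / v := div_nonneg (ha.trans hab) hv.le
    positivity
  have hWm : Measurable fun y : ℝ => y ^ 2 / (2 * v) := (measurable_id.pow_const 2).div_const _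
  exact withDensity_exp_neg_Ico_le_of_logLipschitz hWm hΛ fun x hx y hy =>
    quadratic_logLipschitz hv (ha.trans hab) hx.2.le hy.1 hy.2

end Summit.QuantumFields.YangMills.Theorems.N21HazardBoundedFibre
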